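import Literature.Geometry.Lorentzian.LeafAdaptedModelCharts
import Literature.Geometry.Lorentzian.MinkowskiCauchyDevelopment
import Literature.Geometry.Lorentzian.MinkowskiGlobalHyperbolicity
import Literature.Geometry.Lorentzian.KerrConvergenceProofs
import HarnessLib

/-!
# Leaf-adapted model charts: non-vacuity in Minkowski space

Sanity companion of `LeafAdaptedModelCharts.lean` (definition request `defn-LeafAdaptedModelCharts`,
route FinalStateConjecture/LapseTrumpetKID). The twelve-clause predicate
`LeafAdaptedModelCharts 𝒟 F n U γ b ρ Φ R U₀ Φ₀ τ₀ ξ v ς` is inhabited by the trivial final state: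
Minkowski space as the vacuum Cauchy development of the data `(ℝ³, δ, 0)`
(`Minkowski.vacuumCauchyDevelopment`, `MinkowskiCauchyDevelopment.lean`), foliated by the slabs
`t ↦ {x⁰ = t}` (`F (t, y) = (t, y)`), with NO model chart (`n = 0`) and the identity flat chart
`Φ₀ = Subtype.val` on `U₀ = E4` after `τ₀ = 0` (`leafAdaptedModelCharts_minkowski`). In
particular the leaf-adaptedness, far-domain and EXHAUSTION clauses are jointly satisfiable, and
the exhaustion clause is checked against an honest causal structure: a point of
`J⁺({x⁰ = 0}) ∩ I⁻({x⁰ > 0})` not later than `t₁` lies in the causal past of the flat slab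
`{x⁰ = t₁}` (vertical timelike segment; `Minkowski.causalPast_singleton`).

Ingredients (all proved in the tree): the solid-cone description of `J^±` of a point of Minkowski
space (`Minkowski.causalFuture_singleton`, `Minkowski.causalPast_singleton`,
`MinkowskiGlobalHyperbolicity.lean`; O'Neill 1983, Ch. 14, p. 402), the differential of the
inclusion of an open subset (`OpensChart.mfderiv_subtypeVal_apply`, `KerrConvergenceProofs.lean`),
smoothness of `Subtype.val` on an open submanifold (Mathlib `contMDiff_subtype_val`).

## References

* B. O'Neill, *Semi-Riemannian geometry*, Academic Press 1983, Ch. 14, p. 402 (causality of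
  Minkowski space `ℝ⁴₁`). [ONeill1983]
* D. Christodoulou, S. Klainerman, *The global nonlinear stability of the Minkowski space*,
  Princeton 1993, Thm. 1.0.2 (Minkowski space as the trivial final state). [ChristodoulouKlainerman1993]
-/

noncomputable section

open TopologicalSpace Manifold Filter Topology Set Function
open scoped ContDiff Topology ENNReal

namespace Literature.Geometry.Lorentzian

namespace Minkowski

/-- The causal future of a point of the Minkowski development `Minkowski.vacuumCauchyDevelopment`
is the solid future cone: `‖q̲ − p̲‖ ≤ q⁰ − p⁰ → q ∈ J⁺(p)` (`Minkowski.causalFuture_singleton`,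
transported along the definitional equalities `vacuumCauchyDevelopment.toSpacetime = spacetime`,
`spacetime.metric = η`). O'Neill 1983, Ch. 14, p. 402. [cite: ONeill1983, Ch. 14 p. 402] -/
theorem mem_causalFuture_vacuumCauchyDevelopment {p q : E4}
    (h : ‖E4.spatial q - E4.spatial p‖ ≤ q 0 - p 0) :
    q ∈ vacuumCauchyDevelopment.metric.causalFuture vacuumCauchyDevelopment.timeOrientation
      ({p} : Set E4) := by
  have := (Set.ext_iff.mp (Minkowski.causalFuture_singleton p) q).mpr h
  exact this

/-- The causal past of a point of the Minkowski development is the solid past cone: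
`‖q̲ − x̲‖ ≤ q⁰ − x⁰ → x ∈ J⁻(q)` (`Minkowski.causalPast_singleton`). O'Neill 1983, Ch. 14,
p. 402. [cite: ONeill1983, Ch. 14 p. 402] -/
theorem mem_causalPast_vacuumCauchyDevelopment {q x : E4}
    (h : ‖E4.spatial q - E4.spatial x‖ ≤ q 0 - x 0) :
    x ∈ vacuumCauchyDevelopment.metric.causalPast vacuumCauchyDevelopment.timeOrientation
      ({q} : Set E4) := by
  have := (Set.ext_iff.mp (Minkowski.causalPast_singleton q) x).mpr h
  exact this

/-- The identity flat chart `Subtype.val : E4 ⊇ ⊤ → E4` of the Minkowski development has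
vanishing deviation from `η`: `(ι^* η − η)(x) = 0`, since `dι = id` on the open submanifold
`⊤ ⊆ E4` (`OpensChart.mfderiv_subtypeVal_apply`). Christodoulou–Klainerman 1993, Thm. 1.0.2
(the deviation `g − η`, here for `g = η`). [cite: ChristodoulouKlainerman1993, Thm. 1.0.2] -/
theorem deviation_vacuumCauchyDevelopment_subtypeVal (x : (⊤ : Opens E4)) :
    vacuumCauchyDevelopment.toSpacetime.deviation (Minkowski.backgroundOn ⊤)
      (Subtype.val : (⊤ : Opens E4) → E4) x = 0 := by
  ext v w
  change Minkowski.bilin (mfderiv 𝓘(ℝ, E4) 𝓘(ℝ, E4) (Subtype.val : (⊤ : Opens E4) → E4) x v)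
      (mfderiv 𝓘(ℝ, E4) 𝓘(ℝ, E4) (Subtype.val : (⊤ : Opens E4) → E4) x w) -
    Minkowski.bilin v w = 0
  rw [OpensChart.mfderiv_subtypeVal_apply, OpensChart.mfderiv_subtypeVal_apply, sub_self]

/-- Hence the extended deviation of the identity flat chart vanishes identically (every point of
`E4` is charted). Christodoulou–Klainerman 1993, Thm. 1.0.2. [cite: ChristodoulouKlainerman1993, Thm. 1.0.2] -/
theorem deviationExtend_vacuumCauchyDevelopment_subtypeVal :
    vacuumCauchyDevelopment.toSpacetime.deviationExtend (Minkowski.backgroundOn ⊤)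
      (Subtype.val : (⊤ : Opens E4) → E4) = 0 := by
  funext y
  have := vacuumCauchyDevelopment.toSpacetime.deviationExtend_coe (Minkowski.backgroundOn ⊤)
    (Subtype.val : (⊤ : Opens E4) → E4) ⟨y, trivial⟩
  rw [deviation_vacuumCauchyDevelopment_subtypeVal] at this
  exact this

/-- So the `Cᵏ` deviation of the identity flat chart from `η` is `0` on every slab `{x⁰ = t}`
(`supCkENorm_zero`). Christodoulou–Klainerman 1993, Thm. 1.0.2. [cite: ChristodoulouKlainerman1993, Thm. 1.0.2] -/
theorem deviationCk_vacuumCauchyDevelopment_subtypeVal (k : ℕ) (t : ℝ) :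
    vacuumCauchyDevelopment.toSpacetime.deviationCk (Minkowski.backgroundOn ⊤)
      (Subtype.val : (⊤ : Opens E4) → E4) k t = 0 := by
  rw [Spacetime.deviationCk, deviationExtend_vacuumCauchyDevelopment_subtypeVal, supCkENorm_zero]

/-- The identity flat chart of the Minkowski development is a late-time chart on the flat
background `(E4, η, x⁰, |x̲|)` after any `τ₀` (smooth: Mathlib `contMDiff_subtype_val`; the
restriction to the open half-space `{x⁰ > τ₀}` is an open embedding, being a composite of two
inclusions of open subsets). DHRT arXiv:2104.08222, §1 (late-time charts), trivial instance.
[cite: arXiv210408222, §1] -/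
theorem isLateChart_vacuumCauchyDevelopment_subtypeVal (τ₀ : ℝ) :
    vacuumCauchyDevelopment.toSpacetime.IsLateChart (Minkowski.backgroundOn ⊤) univ τ₀
      (Subtype.val : (⊤ : Opens E4) → E4) := by
  refine ⟨?_, ?_, fun _ _ ↦ trivial⟩
  · exact contMDiff_subtype_val
  · have hlate : IsOpen ((Minkowski.backgroundOn ⊤).lateRegion τ₀) :=
      isOpen_lt continuous_const ((PiLp.continuous_apply 2 _ 0).comp continuous_subtype_val)
    exact (IsOpen.isOpenEmbedding_subtypeVal (⊤ : Opens E4).isOpen).comp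
      (IsOpen.isOpenEmbedding_subtypeVal hlate)

end Minkowski

/-- **Non-vacuity of `LeafAdaptedModelCharts` (the trivial final state).** Minkowski space, as
the vacuum Cauchy development `Minkowski.vacuumCauchyDevelopment` of the data `(ℝ³, δ, 0)`,
foliated by the coordinate slabs `F (t, y) = (t, y)`, with NO model chart (`n = 0`, all
`Fin 0`-indexed data empty) and the identity flat chart `Subtype.val` on `U₀ = ⊤` after `τ₀ = 0`,
satisfies `LeafAdaptedModelCharts`: the flat chart is a late-time chart
(`isLateChart_vacuumCauchyDevelopment_subtypeVal`); it is leaf-adapted (`x = (x⁰, x̲)` lies on the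
leaf `{x⁰} × ℝ³`) with late image in `J⁺({x⁰ = 0})` (vertical segments,
`Minkowski.causalFuture_singleton`); its `C²` deviation from `η` is identically `0`
(`deviationCk_vacuumCauchyDevelopment_subtypeVal`); the far-domain clause is `⊤ ⊇ {x⁰ > 0}`; and
EXHAUSTION holds because a point `q ∉ {x⁰ > t₁}` has `q⁰ ≤ t₁` and hence lies in the causal past of
`(t₁, q̲) ∈ {x⁰ = t₁}` (`Minkowski.causalPast_singleton`). Christodoulou–Klainerman 1993,
Thm. 1.0.2 (Minkowski space is its own final state); O'Neill 1983, Ch. 14, p. 402.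
[cite: ChristodoulouKlainerman1993, Thm. 1.0.2] -/
theorem leafAdaptedModelCharts_minkowski :
    LeafAdaptedModelCharts Minkowski.vacuumCauchyDevelopment
      (fun p : ℝ × Minkowski.slice ↦ (E4.ofTimeSpace p.1 p.2 : E4)) 0 Fin.elim0 (fun i ↦ i.elim0)
      Fin.elim0 Fin.elim0 (fun i ↦ i.elim0) Fin.elim0 ⊤ (Subtype.val : (⊤ : Opens E4) → E4) 0
      Fin.elim0 Fin.elim0 Fin.elim0 := by
  refine ⟨fun i ↦ i.elim0, fun i ↦ i.elim0, fun i ↦ i.elim0, fun i ↦ i.elim0, fun i ↦ i.elim0,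
    fun r ↦ ⟨0, fun i ↦ i.elim0⟩, Minkowski.isLateChart_vacuumCauchyDevelopment_subtypeVal 0,
    ?_, ?_, fun i ↦ i.elim0, fun _ _ _ _ ↦ trivial, ?_⟩
  · -- leaf-adapted, with late image in `J⁺({x⁰ = 0})`
    intro x hx
    refine ⟨?_, ⟨⟨E4.spatial (x : E4), trivial⟩, E4.ofTimeSpace_time_spatial (x : E4)⟩⟩
    have hJ : (x : E4) ∈ Minkowski.vacuumCauchyDevelopment.metric.causalFuture
        Minkowski.vacuumCauchyDevelopment.timeOrientation
        ({E4.ofTimeSpace 0 (E4.spatial (x : E4))} : Set E4) := by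
      refine Minkowski.mem_causalFuture_vacuumCauchyDevelopment ?_
      simp only [E4.spatial_ofTimeSpace, sub_self, norm_zero, E4.ofTimeSpace_apply_zero,
        sub_zero]
      exact hx.le
    refine LorentzianMetric.causalFuture_mono ?_ hJ
    exact Set.singleton_subset_iff.mpr ⟨⟨E4.spatial (x : E4), trivial⟩, rfl⟩
  · -- the `C²` deviation from `η` is identically `0`
    simp only [Minkowski.deviationCk_vacuumCauchyDevelopment_subtypeVal]
    exact tendsto_const_nhds
  · -- exhaustion: a point not later than `t₁` is in the causal past of the slab `{x⁰ = t₁}`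
    intro t₁ _ q hq
    have hq₁ : E4.time q ≤ t₁ :=
      not_lt.mp fun hlt ↦ hq.2 (Or.inl ⟨⟨q, trivial⟩, hlt, rfl⟩)
    have hJ : q ∈ Minkowski.vacuumCauchyDevelopment.metric.causalPast
        Minkowski.vacuumCauchyDevelopment.timeOrientation
        ({E4.ofTimeSpace t₁ (E4.spatial q)} : Set E4) := by
      refine Minkowski.mem_causalPast_vacuumCauchyDevelopment ?_
      simp only [E4.spatial_ofTimeSpace, sub_self, norm_zero, E4.ofTimeSpace_apply_zero,
        sub_nonneg]
      exact hq₁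
    refine LorentzianMetric.causalFuture_mono ?_ hJ
    exact Set.singleton_subset_iff.mpr
      (Or.inl ⟨⟨E4.ofTimeSpace t₁ (E4.spatial q), trivial⟩, rfl, rfl⟩)

/-- Hence the predicate is inhabited for some development and some data (anti-vacuity record).
Christodoulou–Klainerman 1993, Thm. 1.0.2. [cite: ChristodoulouKlainerman1993, Thm. 1.0.2] -/
theorem exists_leafAdaptedModelCharts :
    ∃ (𝒟 : VacuumCauchyDevelopment trivialData) (F : ℝ × Minkowski.slice → 𝒟.carrier)
      (U₀ : Opens E4) (Φ₀ : U₀ → 𝒟.carrier) (τ₀ : ℝ),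
      LeafAdaptedModelCharts 𝒟 F 0 Fin.elim0 (fun i ↦ i.elim0) Fin.elim0 Fin.elim0
        (fun i ↦ i.elim0) Fin.elim0 U₀ Φ₀ τ₀ Fin.elim0 Fin.elim0 Fin.elim0 :=
  ⟨_, _, _, _, _, leafAdaptedModelCharts_minkowski⟩

end Literature.Geometry.Lorentzian

end
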